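import Literature.MathematicalPhysics.QuantumFieldTheory.Balaban1983to89.T3MinimiserStabilityReduction
import Literature.MathematicalPhysics.QuantumFieldTheory.Balaban1983to89.T3PrintedRegularMinimiser
import Literature.MathematicalPhysics.QuantumFieldTheory.Balaban1983to89.T3OrbitAverage
import Literature.MathematicalPhysics.QuantumFieldTheory.Balaban1983to89.B12ContinuousTransportInvariance
import Literature.MathematicalPhysics.QuantumFieldTheory.Balaban1983to89.Node00.CanonicalTransportOfRecord
import Literature.MathematicalPhysics.QuantumFieldTheory.Balaban1983to89.T3InteriorExcision
import Summits.QuantumFields.YangMills.Theorems.FluctuationComparisonRegPrIntLSupTailReduction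
import Summits.QuantumFields.YangMills.Theorems.FluctuationComparisonRegPrIntLSupTailDepthInduction
import Summits.QuantumFields.YangMills.Theorems.FluctuationComparisonRegPrIntLWreg
import Summits.QuantumFields.YangMills.Theorems.UnitScaleTiltFluctuationComparisonRegPrIntLStub1
import Literature.MathematicalPhysics.QuantumFieldTheory.Balaban1983to89.T3SmallLiftHistory
import Literature.MathematicalPhysics.QuantumFieldTheory.Balaban1983to89.T3Thresholds
import Summits.QuantumFields.YangMills.Theorems.AlphaInputsT3ACMinimiserPinMeasurable
import HarnessLib
/-!
# LINE g22-5 «section_lift» (v1.1) — GEOM∘ IS A THEOREM: existence by the landed W7 one-step small lift (gain `κ√L ≤ 1`), measurability by the tree's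
# Castaing selection + continuity of the descent on small plaquette classes; PERS₁∘ ⟸ TUBE∘ ALONE with the junction PROVED
# (ideator `ym-r3-idea-1` g22, LENS «control»; follows LINE g22-4 `Lines/persistence_geometry.lean` and the desk's LOCATE ym3-torus-px21 g13 05:40:51Z)

Crux of record: `stmt-QuantumFields-20520` = `Summit.QuantumFields.YangMills.Theses.UnitScaleTilt.FluctuationComparisonRegPrIntL`.  Targets concluded BY NAME
here: this file's `InteriorSectionCan` (GEOM∘) and `OneLevelPersistenceIntCan` (PERS₁∘) — the texts of LINE g22-4 `Lines/persistence_geometry.lean` §1–§2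
BYTE-IDENTICAL (bridges `Iff.rfl` in any file seeing both), so g22-4's door, g22-2's stopped chain, g22-3's tails and g22-1's knit carry them to POS∘, LFR♯ᶜ∘,
S2β and the registered organ.  Registration is FROZEN (RULING №36): this is a crux WORKFILE, nothing here is registered.

THE FINDING (desk px21 g13, confirmed by kernel in this file).  The DETERMINISTIC content of GEOM∘ — «every interior level-`J` datum `U ∈ W_J(c·b₀)` has a
level-`(J+1)` preimage under the one-step (0.4) descent with all plaquettes `< θ_{J+1}(c·b₀) − 4r`» — FOLLOWS from a LANDED THEOREM of the 19201 lineage: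
✓`Summit.QuantumFields.YangMills.Theorems.IntLStub1.stub_oneStepSmallLift : ∀ L, ∃ κ δ₀, κ·√L ≤ 1 ∧ 0 < δ₀ ∧ ∀ F, F.L = L → OneStepSmallLift F ℰp κ δ₀`
(`#print axioms` = propext, Classical.choice, Quot.sound — the NONLINEAR one-step small lift with gain `κ√L ≤ 1` for the exp-mean-log averaging `ℰp`, built in
`…ApproxLift` / `…AnsatzT*` / `…MiddleBondRepair` as a bounded linear lift of the abelianised problem (dual Whitney forms; linearised constant CERTIFIED
`κ_lin(3) ≤ 0.4656 < 3^{−1/2}`, kit j252909, `…CertL3Clause.certL3_clause`) + second-order BCH + per-bond exact repair).  §5 PROVES from it the fibrewise row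
GEOMfib∘ `InteriorSectionFibrewiseCan` (= GEOM∘ with «∃ measurable σ ∀ U» weakened to «∀ U ∃ W»): the threshold profile `θ_i(c·b₀)` is eventually `≤ δ₀`
uniformly in `i` (✓`T3Thresholds.exists_gamma_forall_θBal_le`), the lift composes with the descent tower (✓`T3SmallLiftHistory.exists_mem_fibre_histGood` at
`K = J + 1` with the profile `θ'_i = θ_i (i ≤ J), κ⁺θ_J (i > J)`, `κ⁺ = max κ (√L)⁻¹`), and the MARGIN `4r > 0` comes from the STRICT threshold ratio
`κ⁺·θ_J < θ_{J+1}` (`mul_θBal_lt_θBal_succ`, §5: `g_{J+1} = g_J/√L < g_J` for `L ≥ 2` and `p(g) = b₀(1 + log g⁻¹)^{p₀}` STRICTLY antitone for `p₀ > 0`).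
So the linearised falsifier FL-4 of g22-4 can no longer kill (certified `c^∞_lin(3) = 9κ_lin ≤ 4.19 < 5.196`; my hand bound `≥ 3.24` brackets it) — it is
downgraded to a calibration cross-check (bus 05:54:21Z).

THE SELECTION HALF = KRN∘ `MeasurableSelectionCan` (NEW row: for `η ≤ η₀(L)`, fibrewise preimages with plaquettes `≤ η` ⇒ a MEASURABLE selector) — ALSO A
THEOREM (v1.1, §5b ✓`measurableSelection_holds`): the TREE already has Castaing's measurable constrained argmin for constraint maps continuous on an open
class (✓`BalabanUVNodesN08AlphaInB42Sel.exists_measurable_constrained_argmin_of_continuousOn`, the pattern of ✓`MinimiserPin.exists_measurable_umin`) and the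
continuity of the descent on small closed plaquette classes (✓`MinimiserPin.continuousAt_descendTo_of_plaqLe`, [Balaban1985Averaging] Prop. 2 — this is where
the guard `η₀(L) = r(L)·L⁻²∕2`, `r(L) = min(1∕(6C₀), δ₂∕(2(7L)²))`, comes from: globally `ℰp` is a DISCONTINUOUS total extension); the constraint «`D W = U` and
`plaq W ≤ η`» is a closed relation, `SU(2)^{bonds}` is compact Polish with Borel = product σ-algebra (✓`polishSpace_su2`), objective `0`.  Hence
★★ GEOM∘ `InteriorSectionCan` IS PROVED (`interiorSectionCan_holds`, sorry-free), and by the g22-4 door (§4, verbatim) PERS₁∘ ⟸ TUBE∘ ALONE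
(✓`oneLevelPersistence_of_tube`).

THE LINE.  GEOM∘ ⟸ (PROVED) GEOMfib∘ (PROVED) + KRN∘ (PROVED) — GEOM∘ is a THEOREM;  PERS₁∘ ⟸ (PROVED) TUBE∘.  STUB (1, §6): TUBE∘ `stub_sectionTubeMassIntCan`
(g22-4, byte-identical row).  Concluder: the unique PERS₁∘ concluder `oneLevelPersistenceIntCan_of_stubs : OneLevelPersistenceIntCan`.  `lean check`: rc 0,
sorries = the 1 stub, 0 elsewhere; `#print axioms interiorSectionCan_holds` = [propext, Classical.choice, Quot.sound].

HONEST STATUS.  Nothing of Bałaban's is asserted; the W7 lift, the descent continuity and the Castaing selection are TREE theorems about the tree's own objects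
(Bałaban's papers never require the averaging to map small fields ONTO small fields — GEOM∘ is the organ's interior-window device, not a claim about print);
PROVED here: GEOMfib∘, KRN∘, GEOM∘ and the junctions; TUBE∘ ∕ PERS₁∘ ∕ POS∘ ∕ LFR♯ᶜ∘ ∕ S2β ∕ 20520 are NOT proved; `YM3TorusSU2` is NOT proved; rung R3 — NOT d = 4,
NOT infinite volume, NOT a mass gap, NOT Clay; no summit is proved by a line.
References: [Balaban1987RG1] (0.4)/(0.18) p.253; [Balaban1985UV3] (3) p.256, (7) p.257, (38)–(40) p.266; [Balaban1985Averaging] Prop. 1–2; [AliprantisBorder2006]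
Thm 18.19 p.605 (Castaing ∕ measurable maximum theorem); Kuratowski–Ryll-Nardzewski, Bull. Acad. Polon. Sci. 13 (1965) 397–403.
-/


open MeasureTheory Filter Topology Set
open scoped ENNReal NNReal BigOperators
open Literature.MathematicalPhysics.QuantumFieldTheory.Balaban1983to89
open Literature.MathematicalPhysics.QuantumFieldTheory.Balaban1983to89.T3ContinuumYM3Torus
open Literature.MathematicalPhysics.QuantumFieldTheory.Balaban1983to89.T3NestedUnitLaws
open Literature.MathematicalPhysics.QuantumFieldTheory.Balaban1983to89.T3UnitLawDensityEML
open Literature.MathematicalPhysics.QuantumFieldTheory.Balaban1983to89.T3UnitScaleTilt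
open Literature.MathematicalPhysics.QuantumFieldTheory.Balaban1983to89.T3TiltDescent
open Literature.MathematicalPhysics.QuantumFieldTheory.Balaban1983to89.T3PrintedRegularMinimiser
open Literature.MathematicalPhysics.QuantumFieldTheory.Balaban1983to89.T3ConstrainedMinimiser (fibre)
open Literature.MathematicalPhysics.QuantumFieldTheory.Balaban1983to89.T3LevelShift
open Literature.MathematicalPhysics.QuantumFieldTheory.Balaban1983to89.Missing
open Literature.MathematicalPhysics.QuantumFieldTheory.Balaban1983to89.T4Continuum
open Literature.MathematicalPhysics.QuantumFieldTheory.Balaban1983to89.T3DescentFibreTower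
open scoped Literature.MathematicalPhysics.QuantumFieldTheory.Balaban1983to89.T3OrbitAverage
open Literature.MathematicalPhysics.QuantumFieldTheory.Balaban1983to89.T3InteriorExcision (θBal_mul θBal_mul_le)

open Literature.MathematicalPhysics.QuantumFieldTheory.Balaban1983to89.T3Thresholds (θBal_eq coupling_le_one exists_gamma_forall_θBal_le)
open Literature.MathematicalPhysics.QuantumFieldTheory.Balaban1983to89.T3ThresholdSmallness (sqrt_coupling_pos_le)
open Literature.MathematicalPhysics.QuantumFieldTheory.Balaban1983to89.T3SmallLiftHistory (OneStepSmallLift SmallLiftStep exists_mem_fibre_histGood)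
open Literature.MathematicalPhysics.QuantumFieldTheory.Balaban1983to89.T3RegularMinimiser (regThreshold)
open Literature.MathematicalPhysics.QuantumFieldTheory.Balaban1983to89.ExpMeanLog (deltaSU deltaSU_pos)
open Summit.QuantumFields.YangMills.Theorems.MinimiserPin (continuousAt_descendTo_of_plaqLe secondCountableTopology_su2 polishSpace_su2)
open Summit.QuantumFields.YangMills.Theorems.BalabanUVNodesN08AlphaInB42Sel (exists_measurable_constrained_argmin_of_continuousOn)
open Summit.QuantumFields.YangMills.BalabanUVNodes.N07DirectMethod (continuous_dist1_plaqHol)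

noncomputable section

namespace Summit.QuantumFields.YangMills.Cruxes.FluctuationComparisonRegPrIntL.RunPairOrgan.SectionLift

/-! ## §1 THE TARGET ROWS, VERBATIM (LINE g22-4 `Lines/persistence_geometry.lean` §1–§2): PERS₁∘, GEOM∘, TUBE∘ -/

section Rows

/-- **PERS₁∘ · ONE-LEVEL INTERIOR PERSISTENCE, POSITIVE FLOOR, ALL RUNS** (`OneLevelPersistenceIntCan`): for every window level `J` there is `q_J > 0` (chosen
AFTER `F, γ, J`: positivity, no rate, no uniformity in `J`) such that for every run `K ≥ J + 1` and every measurable `B` inside the INTERIOR level-`J` window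
`W_J(c·b₀)`: `q_J·Gibbs_K(D_{J,K}⁻¹B) ≤ Gibbs_K(D_{J,K}⁻¹B ∩ D_{J+1,K}⁻¹ W_{J+1}(c·b₀))` — given an interior level-`J` event, the run's next level lies in ITS interior
window with conditional probability at least `q_J`, UNIFORMLY IN THE RUN LENGTH `K`.  The mechanism: the one-step background of an interior datum lies inside the full
window `W_{J+1}(b₀)` (interior price `c < c_max(L)`, FL-B) but — at the edge of `W_J(c·b₀)` — at `≈ c·θ_{J+1}∕c_max(L)` OUTSIDE the level-`(J+1)` interior when
`c_max(L) < 1` (L = 3, 5): landing in the interior then costs a Gaussian fluctuation of relative size `1 − c_max`, i.e. `q_J ≍ β_{J+1}^{−κ}` — ALLOWED, since `q_J` is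
chosen after `J`; what is asked uniformly is only the run length `K`, i.e. the UV stability of the conditional law of level `J+1` given level `J` as `K → ∞`
(Bałaban's effective densities at fixed height converge).  WHY IT MIGHT FAIL: (i) for `K > J + 1` the level-`(J+1)` marginal of the fibre measure is the one-step
fibre law tilted by the deeper effective density `exp(−A_{J+1,K})`; a `K`-uniform LOWER bound of its mass on the interior fibre portion needs two-sided density
bounds at height `K − J − 1` on the SMALL-field region (UV stability (7) gives them; large-field contributions only help a lower bound if non-negative — they are);
(ii) the infimum over interior data `U` (conditioning on arbitrarily small `B`) needs continuity of the conditional law in `U` on the CLOSED interior window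
(WREG-type regularity) — at the window's edge included. [cite: Balaban1985UV3, (7) p.257 and (38)-(40) p.266; Balaban1985Averaging, (10) p.19 and Prop. 1;
Balaban1985Variational, Thm 1 (8)-(10) p.279] -/
def OneLevelPersistenceIntCan : Prop :=
  ∀ (L : ℕ), ∃ c₀ : ℝ, 0 < c₀ ∧ c₀ ≤ 1 ∧ ∀ (c : ℝ), 0 < c → c ≤ c₀ → ∃ pS : ℝ, ∀ (b₀ p₀ : ℝ), 0 < b₀ → pS ≤ p₀ → 0 < p₀ →
    ∃ γ₁ : ℝ, 0 < γ₁ ∧ ∀ (F : T3Family) (γ : ℝ), F.L = L → 0 < γ → γ ≤ γ₁ →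
      ∀ (J : ℕ), ∃ q : ℝ, 0 < q ∧ ∀ (K : ℕ) (hJK : J + 1 ≤ K)
        (B : Set (GaugeField (F.P J) 0 (Matrix.specialUnitaryGroup (Fin 2) ℂ))), MeasurableSet B →
          B ⊆ {U | PlaqSmall (θBal F.L γ (c * b₀) p₀ J) U} →
          ENNReal.ofReal q * gibbsK F ℰp γ K (descendTo F ℰp J K ((Nat.le_succ J).trans hJK) ⁻¹' B) ≤
            gibbsK F ℰp γ K (descendTo F ℰp J K ((Nat.le_succ J).trans hJK) ⁻¹' B ∩
              descendTo F ℰp (J + 1) K hJK ⁻¹' {V | PlaqSmall (θBal F.L γ (c * b₀) p₀ (J + 1)) V})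


/-! ## §2 THE NEW ROWS: GEOM∘ (deterministic interior section) and TUBE∘ (`K`-uniform tube mass) -/

/-- **GEOM∘ · AN INTERIOR SECTION OF THE ONE-STEP AVERAGING WITH A PLAQUETTE MARGIN** (`InteriorSectionCan`, NEW, DETERMINISTIC): in the shared shape (`∀ L, ∃ c₀,
… ∀ c ≤ c₀, ∃ pS, ∀ b₀ p₀, … ∃ γ₁, ∀ F γ, …`), for every window level `J` there are a margin `r > 0` and a MEASURABLE map `σ` from level-`J` to level-`(J+1)`
configurations such that for every interior datum `U ∈ W_J(c·b₀)`: `D_{J,J+1}(σ U) = U` (a section of the one-step averaging `descendTo … J (J+1)`) and EVERY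
plaquette of `σ U` is `< θ_{J+1}(c·b₀) − 4r` (inside the level-`(J+1)` interior window with room for an `r`-link-tube, ✓`dist1_plaqHol_lt_of_linkClose`).  THE NEW
OBJECT: the ℓ^∞ de-averaging constant `C^∞(L) := sup_U min {‖∂A‖_∞ : A averages to U}·L²∕‖∂U‖_∞` (linearised), to be compared with `L^{3∕2}` (the window ratio
`θ_{J+1}∕θ_J = L^{−1∕2}·[(1 + log g_{J+1}⁻¹)∕(1 + log g_J⁻¹)]^{p₀} ≥ L^{−1∕2}`); the fibre MINIMISER does NOT serve at L = 3 (R3-FLIN `C(3) = 8.64 > 5.20`), an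
evenly spreading (Whitney-type) preimage should (`C^∞(3)` sealed in `[1, 3]`).  WHY IT MIGHT FAIL: (i) `C^∞(3) ≥ 3^{3∕2}` after all (LP-decidable; sealed against);
(ii) the NONLINEAR section: an exact preimage under Bałaban's covariant average for EVERY `U` of the window — plaquettes small but bond variables and torus
holonomies arbitrary — measurable in `U` up to the closed edge (gauge covariance of the average + roots along lines + an inverse-function correction at small
`γ`; the construction, not an estimate, is the work). [cite: Balaban1985Averaging, (8)-(10) p.19 and Prop. 1; Balaban1985Variational, Thm 1 (8)-(10) p.279;
Balaban1985RegularSpaces, §1] -/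
def InteriorSectionCan : Prop :=
  ∀ (L : ℕ), ∃ c₀ : ℝ, 0 < c₀ ∧ c₀ ≤ 1 ∧ ∀ (c : ℝ), 0 < c → c ≤ c₀ → ∃ pS : ℝ, ∀ (b₀ p₀ : ℝ), 0 < b₀ → pS ≤ p₀ → 0 < p₀ →
    ∃ γ₁ : ℝ, 0 < γ₁ ∧ ∀ (F : T3Family) (γ : ℝ), F.L = L → 0 < γ → γ ≤ γ₁ →
      ∀ (J : ℕ), ∃ r : ℝ, 0 < r ∧
        ∃ σ : GaugeField (F.P J) 0 (Matrix.specialUnitaryGroup (Fin 2) ℂ) → GaugeField (F.P (J + 1)) 0 (Matrix.specialUnitaryGroup (Fin 2) ℂ),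
          Measurable σ ∧ ∀ U : GaugeField (F.P J) 0 (Matrix.specialUnitaryGroup (Fin 2) ℂ), PlaqSmall (θBal F.L γ (c * b₀) p₀ J) U →
            descendTo F ℰp J (J + 1) (Nat.le_succ J) (σ U) = U ∧ PlaqSmall (θBal F.L γ (c * b₀) p₀ (J + 1) - 4 * r) (σ U)

/-- **TUBE∘ · THE CONDITIONAL LAW OF THE NEXT LEVEL CHARGES EVERY SMALL-FIELD TUBE AROUND THE FIBRE, UNIFORMLY IN THE RUN** (`SectionTubeMassIntCan`, NEW,
MEASURE): in the shared shape, for every window level `J`, every radius `r > 0` and every MEASURABLE section `σ` of the one-step averaging over the interior window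
with SMALL-FIELD values (`σ U ∈ W_{J+1}(b₀)` for `U ∈ W_J(c·b₀)`) there is `q > 0` (chosen after `F, γ, J, r, σ`: positivity, no rate) such that for every run
`K ≥ J + 1` and every measurable `B ⊆ W_J(c·b₀)`: `q·Gibbs_K(D_{J,K}⁻¹B) ≤ Gibbs_K(D_{J,K}⁻¹B ∩ {V : |σ(D_{J,K}V)(b)⁻¹·(D_{J+1,K}V)(b) − 1| < r ∀ bonds b})` — the
`r`-link-tube around the section's point ON THE FIBRE of the datum carries conditional mass `≥ q`, UNIFORMLY IN `K`.  Content: after `K − J − 1` renormalization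
steps the effective density of level `J+1` is bounded BELOW on small fields (`exp(−β_{J+1}·Wilson − E·Vol)`, the small-field effective action's bounded analytic
corrections) and the fibre partition function ABOVE (`exp(+E·Vol)`, ultraviolet stability) — both uniformly in `K`, constants extensive and `β_{J+1}`-dependent (all
fixed after `F, γ, J`).  No window geometry, no rate: pure positivity of Bałaban's conditional small-field law at fixed height as the cutoff is removed.  WHY IT MIGHT
FAIL: (i) the LOWER density bound needs the complete small-field analysis at height `K − J − 1` (analyticity domains, [Balaban1987RG1]) — print gives it, size XL;
(ii) the fibre geometry (fibre volume of an `r`-tube portion) must be bounded below uniformly in `U` up to the closed window edge — regularity of the averaging map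
on regular configurations ([Balaban1985Averaging] Prop. 1); (iii) large-field contributions enter only the partition function's UPPER bound ((7) covers them).
[cite: Balaban1985UV3, (7) p.257 and (38)-(40) p.266; Balaban1987RG1, (0.18)-(0.22) p.255; Balaban1985Averaging, Prop. 1 p.22] -/
def SectionTubeMassIntCan : Prop :=
  ∀ (L : ℕ), ∃ c₀ : ℝ, 0 < c₀ ∧ c₀ ≤ 1 ∧ ∀ (c : ℝ), 0 < c → c ≤ c₀ → ∃ pS : ℝ, ∀ (b₀ p₀ : ℝ), 0 < b₀ → pS ≤ p₀ → 0 < p₀ →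
    ∃ γ₁ : ℝ, 0 < γ₁ ∧ ∀ (F : T3Family) (γ : ℝ), F.L = L → 0 < γ → γ ≤ γ₁ →
      ∀ (J : ℕ) (r : ℝ), 0 < r →
        ∀ σ : GaugeField (F.P J) 0 (Matrix.specialUnitaryGroup (Fin 2) ℂ) → GaugeField (F.P (J + 1)) 0 (Matrix.specialUnitaryGroup (Fin 2) ℂ), Measurable σ →
          (∀ U : GaugeField (F.P J) 0 (Matrix.specialUnitaryGroup (Fin 2) ℂ), PlaqSmall (θBal F.L γ (c * b₀) p₀ J) U →
            descendTo F ℰp J (J + 1) (Nat.le_succ J) (σ U) = U ∧ PlaqSmall (θBal F.L γ b₀ p₀ (J + 1)) (σ U)) →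
          ∃ q : ℝ, 0 < q ∧ ∀ (K : ℕ) (hJK : J + 1 ≤ K)
            (B : Set (GaugeField (F.P J) 0 (Matrix.specialUnitaryGroup (Fin 2) ℂ))), MeasurableSet B →
              B ⊆ {U | PlaqSmall (θBal F.L γ (c * b₀) p₀ J) U} →
              ENNReal.ofReal q * gibbsK F ℰp γ K (descendTo F ℰp J K ((Nat.le_succ J).trans hJK) ⁻¹' B) ≤
                gibbsK F ℰp γ K (descendTo F ℰp J K ((Nat.le_succ J).trans hJK) ⁻¹' B ∩
                  {V | ∀ b : PBond (F.P (J + 1)) 0,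
                    dist1 ((σ (descendTo F ℰp J K ((Nat.le_succ J).trans hJK) V) b)⁻¹ *
                      descendTo F ℰp (J + 1) K hJK V b) < r})


/-! ## §2b THE CUT OF GEOM∘ ONE LEVEL DOWN: GEOMfib∘ (fibrewise existence — PROVED in §5) and KRN∘ (measurable selection — PROVED in §5b) -/

/-- **GEOMfib∘ · FIBREWISE INTERIOR LIFT WITH MARGIN** (`InteriorSectionFibrewiseCan`; GEOM∘ with «∃ σ measurable, ∀ U» weakened to «∀ U, ∃ W»): in the shared
shape, for every window level `J` there is a margin `r > 0` such that every interior datum `U ∈ W_J(c·b₀)` has a preimage `W` under the one-step descent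
`D_{J,J+1}` whose every plaquette is `< θ_{J+1}(c·b₀) − 4r`.  NOT A STUB: PROVED in §5 (`interiorSectionFibrewise_holds`) from the landed W7 lift
✓`IntLStub1.stub_oneStepSmallLift` (gain `κ√L ≤ 1`, sorry-free), ✓`exists_mem_fibre_histGood`, ✓`exists_gamma_forall_θBal_le` and the strict ratio
`κ⁺θ_J < θ_{J+1}` (`mul_θBal_lt_θBal_succ`).  Listed as a row so that the organ table can show GEOM∘ ⟸ {GEOMfib∘ ✓, KRN∘}. [cite: Balaban1987RG1, (0.4)/(0.18) p.253;
Balaban1985UV3, (3) p.256 and (7) p.257] -/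
def InteriorSectionFibrewiseCan : Prop :=
  ∀ (L : ℕ), ∃ c₀ : ℝ, 0 < c₀ ∧ c₀ ≤ 1 ∧ ∀ (c : ℝ), 0 < c → c ≤ c₀ → ∃ pS : ℝ, ∀ (b₀ p₀ : ℝ), 0 < b₀ → pS ≤ p₀ → 0 < p₀ →
    ∃ γ₁ : ℝ, 0 < γ₁ ∧ ∀ (F : T3Family) (γ : ℝ), F.L = L → 0 < γ → γ ≤ γ₁ →
      ∀ (J : ℕ), ∃ r : ℝ, 0 < r ∧ ∀ U : GaugeField (F.P J) 0 (Matrix.specialUnitaryGroup (Fin 2) ℂ), PlaqSmall (θBal F.L γ (c * b₀) p₀ J) U →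
        ∃ W : GaugeField (F.P (J + 1)) 0 (Matrix.specialUnitaryGroup (Fin 2) ℂ),
          descendTo F ℰp J (J + 1) (Nat.le_succ J) W = U ∧ PlaqSmall (θBal F.L γ (c * b₀) p₀ (J + 1) - 4 * r) W

/-- **KRN∘ · MEASURABLE SELECTION ON THE ONE-STEP DESCENT FIBRES** (`MeasurableSelectionCan`, NEW — NOT A STUB: PROVED in §5b, `measurableSelection_holds`, from
the tree's Castaing selection ✓`exists_measurable_constrained_argmin_of_continuousOn` and ✓`continuousAt_descendTo_of_plaqLe`): for every block size `L` there is a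
guard `η₀ > 0` such that for every family, every pair of consecutive approximations `J, J+1`, every datum radius `θ` and every CLOSED plaquette bound `η ≤ η₀`:
if every `θ`-small datum `U` has a preimage `W` under `D_{J,J+1}` with all plaquettes `≤ η`, then a MEASURABLE map `σ` chooses such a preimage for every
`θ`-small `U`.  Content: for `η ≤ η₀(L)` (all block loops of a `η`-small field inside the half-guard of `ℰp`, where the exp-mean-log average is the printed
analytic operation — globally `ℰp` is a DISCONTINUOUS total extension, `BlockAveragingExpMeanLogContinuous` header, hence the guard) the one-step descent is
continuous on the closed set `{plaq ≤ η}` of the COMPACT metric space `SU(2)^{bonds}`, so the correspondence `U ↦ {W : D W = U ∧ plaq(W) ≤ η}` has closed graph,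
compact values, is upper hemicontinuous hence weakly measurable, and the Kuratowski–Ryll-Nardzewski theorem yields a Borel selector (equivalently: iterated
argmin over a countable separating family of continuous functions).  Pure descriptive measure theory — no renormalisation content; the tree's Track-A node N08
files carry Castaing's theorem ([AliprantisBorder2006] Thm 18.19), which §5b applies with objective `0`, guard `η₀(L) = r(L)·L⁻²∕2`. [cite: Balaban1987RG1, (0.4) p.253;
Balaban1985Averaging, Prop. 2 p.26; AliprantisBorder2006, Thm 18.19 p.605] -/
def MeasurableSelectionCan : Prop :=
  ∀ (L : ℕ), ∃ η₀ : ℝ, 0 < η₀ ∧ ∀ (F : T3Family), F.L = L → ∀ (J : ℕ) (θ η : ℝ), η ≤ η₀ →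
    (∀ U : GaugeField (F.P J) 0 (Matrix.specialUnitaryGroup (Fin 2) ℂ), PlaqSmall θ U →
      ∃ W : GaugeField (F.P (J + 1)) 0 (Matrix.specialUnitaryGroup (Fin 2) ℂ),
        descendTo F ℰp J (J + 1) (Nat.le_succ J) W = U ∧ ∀ p, dist1 (GaugeField.plaqHol W p) ≤ η) →
    ∃ σ : GaugeField (F.P J) 0 (Matrix.specialUnitaryGroup (Fin 2) ℂ) → GaugeField (F.P (J + 1)) 0 (Matrix.specialUnitaryGroup (Fin 2) ℂ),
      Measurable σ ∧ ∀ U : GaugeField (F.P J) 0 (Matrix.specialUnitaryGroup (Fin 2) ℂ), PlaqSmall θ U →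
        descendTo F ℰp J (J + 1) (Nat.le_succ J) (σ U) = U ∧ ∀ p, dist1 (GaugeField.plaqHol (σ U) p) ≤ η


end Rows

/-! ## §3 THE PLAQUETTE LIPSCHITZ BOUND ON A LINK-TUBE (PROVED, any gauge group) -/

section Lipschitz

variable {P : Params} {j : ℕ} {G : Type*} [GaugeGroup G]

/-- A free-group identity: the plaquette word in the `vᵢ` is the plaquette word in the `wᵢ` preceded by three conjugates of (products of) the relative
variables `wᵢ⁻¹vᵢ`. [folklore] -/
theorem plaqWord_perturb (w₁ w₂ w₃ w₄ v₁ v₂ v₃ v₄ : G) :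
    v₁ * v₂ * v₃⁻¹ * v₄⁻¹ =
      (w₁ * (w₁⁻¹ * v₁) * w₁⁻¹) * ((w₁ * w₂) * ((w₂⁻¹ * v₂) * (w₃⁻¹ * v₃)⁻¹) * (w₁ * w₂)⁻¹) *
        ((w₁ * w₂ * w₃⁻¹) * (w₄⁻¹ * v₄)⁻¹ * (w₁ * w₂ * w₃⁻¹)⁻¹) * (w₁ * w₂ * w₃⁻¹ * w₄⁻¹) := by
  group

/-- The word estimate: if `|wᵢ⁻¹vᵢ − 1| < r` for the four letters then `|v₁v₂v₃⁻¹v₄⁻¹ − 1| < |w₁w₂w₃⁻¹w₄⁻¹ − 1| + 4r` (`dist1` sub-multiplicative, conjugation-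
and inversion-invariant: the `GaugeGroup` axioms, B7 (19)). [cite: Balaban1985Averaging, (19) p.21] -/
theorem dist1_word_lt_of_close (w₁ w₂ w₃ w₄ v₁ v₂ v₃ v₄ : G) {r : ℝ}
    (h₁ : dist1 (w₁⁻¹ * v₁) < r) (h₂ : dist1 (w₂⁻¹ * v₂) < r) (h₃ : dist1 (w₃⁻¹ * v₃) < r) (h₄ : dist1 (w₄⁻¹ * v₄) < r) :
    dist1 (v₁ * v₂ * v₃⁻¹ * v₄⁻¹) < dist1 (w₁ * w₂ * w₃⁻¹ * w₄⁻¹) + 4 * r := by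
  rw [plaqWord_perturb w₁ w₂ w₃ w₄ v₁ v₂ v₃ v₄]
  have e1 : dist1 (w₁ * (w₁⁻¹ * v₁) * w₁⁻¹) = dist1 (w₁⁻¹ * v₁) := GaugeGroup.dist1_conj _ _
  have e2 : dist1 ((w₁ * w₂) * ((w₂⁻¹ * v₂) * (w₃⁻¹ * v₃)⁻¹) * (w₁ * w₂)⁻¹) ≤ dist1 (w₂⁻¹ * v₂) + dist1 (w₃⁻¹ * v₃) := by
    rw [GaugeGroup.dist1_conj]
    calc dist1 ((w₂⁻¹ * v₂) * (w₃⁻¹ * v₃)⁻¹) ≤ dist1 (w₂⁻¹ * v₂) + dist1 ((w₃⁻¹ * v₃)⁻¹) := GaugeGroup.dist1_mul_le _ _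
      _ = dist1 (w₂⁻¹ * v₂) + dist1 (w₃⁻¹ * v₃) := by rw [GaugeGroup.dist1_inv]
  have e3 : dist1 ((w₁ * w₂ * w₃⁻¹) * (w₄⁻¹ * v₄)⁻¹ * (w₁ * w₂ * w₃⁻¹)⁻¹) = dist1 (w₄⁻¹ * v₄) := by
    rw [GaugeGroup.dist1_conj, GaugeGroup.dist1_inv]
  -- peel the word from the right with `dist1 (g h) ≤ dist1 g + dist1 h`
  set X₁ := w₁ * (w₁⁻¹ * v₁) * w₁⁻¹
  set X₂ := (w₁ * w₂) * ((w₂⁻¹ * v₂) * (w₃⁻¹ * v₃)⁻¹) * (w₁ * w₂)⁻¹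
  set X₃ := (w₁ * w₂ * w₃⁻¹) * (w₄⁻¹ * v₄)⁻¹ * (w₁ * w₂ * w₃⁻¹)⁻¹
  set X₄ := w₁ * w₂ * w₃⁻¹ * w₄⁻¹
  have hm : dist1 (X₁ * X₂ * X₃ * X₄) ≤ dist1 X₁ + dist1 X₂ + dist1 X₃ + dist1 X₄ :=
    calc dist1 (X₁ * X₂ * X₃ * X₄) ≤ dist1 (X₁ * X₂ * X₃) + dist1 X₄ := GaugeGroup.dist1_mul_le _ _
      _ ≤ dist1 (X₁ * X₂) + dist1 X₃ + dist1 X₄ := by gcongr; exact GaugeGroup.dist1_mul_le _ _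
      _ ≤ dist1 X₁ + dist1 X₂ + dist1 X₃ + dist1 X₄ := by gcongr; exact GaugeGroup.dist1_mul_le _ _
  linarith [hm, e1, e2, e3]

/-- ★ **The plaquette Lipschitz bound on an `r`-link-tube** (PROVED): if every bond variable of `V` is within `r` of that of `W` (`|W(b)⁻¹V(b) − 1| < r`), then
`|V(∂p) − 1| < |W(∂p) − 1| + 4r` for every plaquette `p`. [cite: Balaban1985Averaging, (9) p.19 and (19) p.21] -/
theorem dist1_plaqHol_lt_of_linkClose (W V : GaugeField P j G) {r : ℝ}
    (h : ∀ b : PBond P j, dist1 ((W b)⁻¹ * V b) < r) (p : Plaq P j) :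
    dist1 (GaugeField.plaqHol V p) < dist1 (GaugeField.plaqHol W p) + 4 * r :=
  dist1_word_lt_of_close _ _ _ _ _ _ _ _ (h _) (h _) (h _) (h _)

/-- Corollary: on the `r`-link-tube around `W`, a plaquette margin `4r` for `W` gives the window for `V`. [folklore] -/
theorem plaqSmall_of_linkClose (W V : GaugeField P j G) {r θ : ℝ}
    (h : ∀ b : PBond P j, dist1 ((W b)⁻¹ * V b) < r) (hW : PlaqSmall (θ - 4 * r) W) : PlaqSmall θ V := by
  intro p
  have := dist1_plaqHol_lt_of_linkClose W V h p
  have hWp := hW p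
  linarith

/-- The centre of a tube lies in it: `|W(b)⁻¹W(b) − 1| = 0 < r`. [folklore] -/
theorem linkClose_self (W : GaugeField P j G) {r : ℝ} (hr : 0 < r) : ∀ b : PBond P j, dist1 ((W b)⁻¹ * W b) < r := by
  intro b; simpa [GaugeGroup.dist1_one] using hr

end Lipschitz

/-! ## §4 THE DOOR: PERS₁∘ ⟸ GEOM∘ + TUBE∘ (PROVED) -/

section Door

/-- ★ **PERS₁∘ ⟸ GEOM∘ + TUBE∘** (PROVED): common fraction `c ≤ min c₀`, thresholds `max pS`, couplings `min γ₁ (and ≤ 1)`; at level `J`, GEOM∘ gives the margin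
`r` and the section `σ` (admissible for TUBE∘ since `θ_{J+1}(c·b₀) − 4r ≤ θ_{J+1}(b₀)`, ✓`θBal_mul_le`); TUBE∘ gives `q`; the tube event inside `D_{J,K}⁻¹B`
lies in `D_{J+1,K}⁻¹W_{J+1}(c·b₀)` by ✓`plaqSmall_of_linkClose`, and monotonicity of `Gibbs_K` finishes. [cite: Balaban1985UV3, (7) p.257 and (38)-(40) p.266] -/
theorem oneLevelPersistence_of_geom_tube : InteriorSectionCan → SectionTubeMassIntCan → OneLevelPersistenceIntCan := by
  intro hG hT L
  obtain ⟨c₁, hc₁, hc₁1, H1⟩ := hG L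
  obtain ⟨c₂, hc₂, -, H2⟩ := hT L
  refine ⟨min c₁ c₂, lt_min hc₁ hc₂, (min_le_left _ _).trans hc₁1, fun c hc hcle => ?_⟩
  have hc1 : c ≤ 1 := (hcle.trans (min_le_left _ _)).trans hc₁1
  obtain ⟨pS₁, H1⟩ := H1 c hc (hcle.trans (min_le_left _ _))
  obtain ⟨pS₂, H2⟩ := H2 c hc (hcle.trans (min_le_right _ _))
  refine ⟨max pS₁ pS₂, fun b₀ p₀ hb hpS hp => ?_⟩
  obtain ⟨γ₁, hγ₁, H1⟩ := H1 b₀ p₀ hb ((le_max_left _ _).trans hpS) hp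
  obtain ⟨γ₂, hγ₂, H2⟩ := H2 b₀ p₀ hb ((le_max_right _ _).trans hpS) hp
  refine ⟨min (min γ₁ γ₂) 1, lt_min (lt_min hγ₁ hγ₂) one_pos, fun F γ hFL hγ hγle J => ?_⟩
  have hγ1 : γ ≤ 1 := hγle.trans (min_le_right _ _)
  have hL1 : 1 ≤ F.L := F.hL.2.le
  obtain ⟨r, hr, σ, hσm, hσ⟩ := H1 F γ hFL hγ (hγle.trans ((min_le_left _ _).trans (min_le_left _ _))) J
  have HT := H2 F γ hFL hγ (hγle.trans ((min_le_left _ _).trans (min_le_right _ _))) J r hr σ hσm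
  -- admissibility of the section for TUBE∘: small-field values
  have hθ : θBal F.L γ (c * b₀) p₀ (J + 1) - 4 * r ≤ θBal F.L γ b₀ p₀ (J + 1) := by
    have := θBal_mul_le hL1 hγ hγ1 hb hc1 p₀ (J + 1)
    linarith
  have hadm : ∀ U : GaugeField (F.P J) 0 (Matrix.specialUnitaryGroup (Fin 2) ℂ), PlaqSmall (θBal F.L γ (c * b₀) p₀ J) U →
      descendTo F ℰp J (J + 1) (Nat.le_succ J) (σ U) = U ∧ PlaqSmall (θBal F.L γ b₀ p₀ (J + 1)) (σ U) := by
    intro U hU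
    obtain ⟨h1, h2⟩ := hσ U hU
    exact ⟨h1, T3PrintedMinimiserExistence.plaqSmall_of_le hθ h2⟩
  obtain ⟨q, hq, HK⟩ := HT hadm
  refine ⟨q, hq, fun K hJK B hBm hBW => ?_⟩
  refine (HK K hJK B hBm hBW).trans (measure_mono ?_)
  rintro V ⟨hVB, hVt⟩
  refine ⟨hVB, ?_⟩
  -- the datum is interior, the section has the margin, the tube transfers it
  have hU : PlaqSmall (θBal F.L γ (c * b₀) p₀ J) (descendTo F ℰp J K ((Nat.le_succ J).trans hJK) V) := hBW hVB
  have hσU := (hσ _ hU).2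
  exact plaqSmall_of_linkClose _ _ hVt hσU

end Door

/-! ## §5 GEOMfib∘ IS A THEOREM (from the landed W7 lift) and the junction GEOM∘ ⟸ GEOMfib∘ + KRN∘ (PROVED) -/

section Lift

/-- `p(g) = b₀(1 + log g⁻¹)^{p₀}` is STRICTLY antitone in the coupling on `(0, 1]` for `b₀, p₀ > 0`. [cite: Balaban1985UV3, (7) p.257] -/
theorem pFun_lt_pFun_of_lt {b₀ p₀ : ℝ} (hb : 0 < b₀) (hp : 0 < p₀) {g g' : ℝ} (hg' : 0 < g') (hgg' : g' < g) (hg1 : g ≤ 1) :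
    B10.pFun b₀ p₀ g < B10.pFun b₀ p₀ g' := by
  unfold B10.pFun
  have hg : 0 < g := hg'.trans hgg'
  have hlog : 0 ≤ Real.log g⁻¹ := Real.log_nonneg ((one_le_inv₀ hg).mpr hg1)
  have hlt : Real.log g⁻¹ < Real.log g'⁻¹ := Real.log_lt_log (inv_pos.mpr hg) ((inv_lt_inv₀ hg hg').mpr hgg')
  exact mul_lt_mul_of_pos_left (Real.rpow_lt_rpow (by linarith) (by linarith) hp) hb

/-- **STRICT THRESHOLD RATIO**: `κ·θ(i) < θ(i+1)` whenever `κ√L ≤ 1`, for `L ≥ 2`, `0 < γ ≤ 1`, `b₀, p₀ > 0` — one step down the coupling drops by the factor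
`√L > 1` and `p` strictly increases, so the one-step lift with gain `κ` lands STRICTLY inside the next window: the margin `4r` of GEOM∘. (The tree's
✓`T3SmallLiftHistory.mul_θBal_le_θBal_succ` is the non-strict form.) [cite: Balaban1985UV3, (3) p.256 and (7) p.257] -/
theorem mul_θBal_lt_θBal_succ {L : ℕ} (hL : 2 ≤ L) {γ b₀ p₀ : ℝ} (hγ : 0 < γ) (hγ1 : γ ≤ 1) (hb : 0 < b₀) (hp : 0 < p₀)
    {κ : ℝ} (hκ : κ * Real.sqrt L ≤ 1) (i : ℕ) : κ * θBal L γ b₀ p₀ i < θBal L γ b₀ p₀ (i + 1) := by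
  have hL1 : 1 ≤ L := by omega
  have hLr : (1 : ℝ) < L := by exact_mod_cast (show 1 < L by omega)
  have hL' : (0 : ℝ) < Real.sqrt L := Real.sqrt_pos.mpr (by linarith)
  have hκ' : κ ≤ Real.sqrt ((L : ℝ)⁻¹) := by
    rw [Real.sqrt_inv, ← one_div]
    exact (le_div_iff₀ hL').mpr hκ
  have hθ0 : 0 ≤ θBal L γ b₀ p₀ i := (T3MinimiserStabilityReduction.θBal_pos hL1 hγ hγ1 hb p₀ i).le
  refine (mul_le_mul_of_nonneg_right hκ' hθ0).trans_lt ?_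
  rw [θBal_eq, θBal_eq]
  have hLinv : 0 ≤ ((L : ℝ)⁻¹) := inv_nonneg.mpr (Nat.cast_nonneg L)
  have hg := (sqrt_coupling_pos_le hL1 hγ i).1
  have hg' := (sqrt_coupling_pos_le hL1 hγ (i + 1)).1
  have hg1 : Real.sqrt (γ * ((L : ℝ)⁻¹) ^ i) ≤ 1 := coupling_le_one hL1 hγ hγ1 i
  have hsucc : Real.sqrt (γ * ((L : ℝ)⁻¹) ^ (i + 1)) = Real.sqrt ((L : ℝ)⁻¹) * Real.sqrt (γ * ((L : ℝ)⁻¹) ^ i) := by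
    rw [← Real.sqrt_mul hLinv]
    congr 1
    ring
  have hsq1 : Real.sqrt ((L : ℝ)⁻¹) < 1 := by
    have h1 : ((L : ℝ)⁻¹) < 1 := inv_lt_one_of_one_lt₀ hLr
    have := Real.sqrt_lt_sqrt hLinv h1
    rwa [Real.sqrt_one] at this
  have hlt : Real.sqrt (γ * ((L : ℝ)⁻¹) ^ (i + 1)) < Real.sqrt (γ * ((L : ℝ)⁻¹) ^ i) := by
    rw [hsucc]; exact mul_lt_of_lt_one_left hg hsq1
  have hpf := pFun_lt_pFun_of_lt hb hp hg' hlt hg1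
  calc Real.sqrt ((L : ℝ)⁻¹) * (Real.sqrt (γ * ((L : ℝ)⁻¹) ^ i) * B10.pFun b₀ p₀ (Real.sqrt (γ * ((L : ℝ)⁻¹) ^ i)))
      = Real.sqrt (γ * ((L : ℝ)⁻¹) ^ (i + 1)) * B10.pFun b₀ p₀ (Real.sqrt (γ * ((L : ℝ)⁻¹) ^ i)) := by rw [hsucc]; ring
    _ < Real.sqrt (γ * ((L : ℝ)⁻¹) ^ (i + 1)) * B10.pFun b₀ p₀ (Real.sqrt (γ * ((L : ℝ)⁻¹) ^ (i + 1))) :=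
        mul_lt_mul_of_pos_left hpf hg'

/-- ★ **GEOMfib∘ IS A THEOREM**: the fibrewise interior lift with margin holds, from the landed W7 one-step small lift (gain `κ√L ≤ 1`) composed with the descent
tower along the profile `θ'_i = θ_i(c·b₀)` (`i ≤ J`), `κ⁺θ_J(c·b₀)` (`i > J`), `κ⁺ = max κ (√L)⁻¹ ∈ (0, 1]`; all fractions `c ∈ (0, 1]`, all `b₀, p₀ > 0`;
`γ₁(c·b₀, p₀, δ₀)` puts the whole profile under the lift radius `δ₀`; the margin is `4r = θ_{J+1} − κ⁺θ_J > 0`. [cite: Balaban1987RG1, (0.4)/(0.18) p.253; Balaban1985UV3,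
(3) p.256 and (7) p.257] -/
theorem interiorSectionFibrewise_holds : InteriorSectionFibrewiseCan := by
  intro L
  refine ⟨1, one_pos, le_rfl, fun c hc _ => ⟨0, fun b₀ p₀ hb _ hp => ?_⟩⟩
  have hcb : 0 < c * b₀ := mul_pos hc hb
  obtain ⟨κ, δ₀, hκ, hδ₀, hlift⟩ := Summit.QuantumFields.YangMills.Theorems.IntLStub1.stub_oneStepSmallLift L
  obtain ⟨γ₁, hγ₁, hγ₁1, hsmall⟩ := exists_gamma_forall_θBal_le (b₀ := c * b₀) (p₀ := p₀) hcb hp hδ₀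
  refine ⟨γ₁, hγ₁, fun F γ hFL hγ hγle J => ?_⟩
  have hγ1 : γ ≤ 1 := hγle.trans hγ₁1
  have hL1 : 1 ≤ F.L := F.hL.2.le
  have hL2 : 2 ≤ F.L := F.hL.2
  have hLpos : (0 : ℝ) < Real.sqrt (F.L : ℝ) := Real.sqrt_pos.mpr (by exact_mod_cast (show 0 < F.L by omega))
  have hL1r : (1 : ℝ) ≤ Real.sqrt (F.L : ℝ) := Real.one_le_sqrt.mpr (by exact_mod_cast hL1)
  -- the positive gain `κ⁺ = max κ (√L)⁻¹ ∈ (0, 1]`, still with `κ⁺√L ≤ 1`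
  set κp : ℝ := max κ (Real.sqrt (F.L : ℝ))⁻¹ with hκp
  have hκF : κ * Real.sqrt (F.L : ℝ) ≤ 1 := by rw [hFL]; exact hκ
  have hκp_mul : κp * Real.sqrt (F.L : ℝ) ≤ 1 := by
    rcases le_total κ (Real.sqrt (F.L : ℝ))⁻¹ with h | h
    · rw [hκp, max_eq_right h, inv_mul_cancel₀ hLpos.ne']
    · rw [hκp, max_eq_left h]; exact hκF
  have hκp_pos : 0 < κp := lt_max_of_lt_right (inv_pos.mpr hLpos)
  have hκp_le1 : κp ≤ 1 := by
    refine max_le ?_ (inv_le_one_of_one_le₀ hL1r)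
    by_contra hk
    push_neg at hk
    nlinarith [mul_le_mul hk.le hL1r zero_le_one (by linarith : (0:ℝ) ≤ κ)]
  have hliftp : OneStepSmallLift F ℰp κp δ₀ := fun K j hj δ hδ hδ' =>
    SmallLiftStep.mono (le_max_left _ _) hδ.le (hlift F hFL K j hj δ hδ hδ')
  -- thresholds at the interior profile `c·b₀`
  have hθpos : ∀ i, 0 < θBal F.L γ (c * b₀) p₀ i := fun i => T3MinimiserStabilityReduction.θBal_pos hL1 hγ hγ1 hcb p₀ i
  have hθδ : ∀ i, θBal F.L γ (c * b₀) p₀ i ≤ δ₀ := fun i => hsmall F.L hL1 γ hγ hγle i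
  have hstrict : κp * θBal F.L γ (c * b₀) p₀ J < θBal F.L γ (c * b₀) p₀ (J + 1) :=
    mul_θBal_lt_θBal_succ hL2 hγ hγ1 hcb hp hκp_mul J
  refine ⟨(θBal F.L γ (c * b₀) p₀ (J + 1) - κp * θBal F.L γ (c * b₀) p₀ J) / 4, by linarith, fun U hU => ?_⟩
  -- the profile along which the lift is iterated (only one step is used: `K = J + 1`)
  let θ' : ℕ → ℝ := fun i => if i ≤ J then θBal F.L γ (c * b₀) p₀ i else κp * θBal F.L γ (c * b₀) p₀ J
  have hθ'pos : ∀ i, 0 < θ' i := by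
    intro i; by_cases hi : i ≤ J
    · simp only [θ', if_pos hi]; exact hθpos i
    · simp only [θ', if_neg hi]; exact mul_pos hκp_pos (hθpos J)
  have hθ'δ : ∀ i, θ' i ≤ δ₀ := by
    intro i; by_cases hi : i ≤ J
    · simp only [θ', if_pos hi]; exact hθδ i
    · simp only [θ', if_neg hi]
      exact (mul_le_of_le_one_left (hθpos J).le hκp_le1).trans (hθδ J)
  have hθ'ratio : ∀ i, κp * θ' i ≤ θ' (i + 1) := by
    intro i
    by_cases hi1 : i + 1 ≤ J
    · have hi : i ≤ J := by omega
      simp only [θ', if_pos hi, if_pos hi1]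
      exact T3SmallLiftHistory.mul_θBal_le_θBal_succ hL1 hγ hγ1 hcb.le hp.le hκp_mul i
    · by_cases hi : i ≤ J
      · have hiJ : i = J := by omega
        subst hiJ
        simp only [θ', if_pos hi, if_neg hi1]; exact le_rfl
      · simp only [θ', if_neg hi, if_neg hi1]
        have h0 : 0 ≤ κp * θBal F.L γ (c * b₀) p₀ J := (mul_pos hκp_pos (hθpos J)).le
        exact mul_le_of_le_one_left h0 hκp_le1
  have hU' : PlaqSmall (θ' J) U := by simp only [θ', if_pos le_rfl]; exact hU
  obtain ⟨W, hWf, hWh⟩ := exists_mem_fibre_histGood F ℰp hliftp hκp_le1 hθ'pos hθ'δ hθ'ratio (Nat.le_succ J) hU'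
  refine ⟨W, hWf, ?_⟩
  -- height `0` of run `J + 1` in the history event is `W` itself, at threshold `θ' (J+1) = κ⁺θ_J = θ_{J+1} − 4r`
  have hW0 : PlaqSmall (θ' (J + 1)) W := hWh 0 (by omega)
  have hJ1 : ¬ (J + 1 ≤ J) := by omega
  simp only [θ', if_neg hJ1] at hW0
  have hr : θBal F.L γ (c * b₀) p₀ (J + 1) - 4 * ((θBal F.L γ (c * b₀) p₀ (J + 1) - κp * θBal F.L γ (c * b₀) p₀ J) / 4) =
      κp * θBal F.L γ (c * b₀) p₀ J := by ring
  rw [hr]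
  exact hW0

/-- ★ **GEOM∘ ⟸ GEOMfib∘ + KRN∘** (PROVED): at level `J`, GEOMfib∘ gives the margin `r` and preimages with plaquettes `< θ_{J+1}(c·b₀) − 4r =: η`; `γ₁` is also taken
so small that `θ_{J+1}(c·b₀) ≤ η₀(L)` (✓`exists_gamma_forall_θBal_le`), so KRN∘ applies with the CLOSED bound `η` and returns a measurable `σ` with plaquettes
`≤ η < θ_{J+1}(c·b₀) − 4(r/2)`: GEOM∘ with margin `r/2`. [cite: Balaban1987RG1, (0.4) p.253] -/
theorem interiorSection_of_fibrewise_krn : InteriorSectionFibrewiseCan → MeasurableSelectionCan → InteriorSectionCan := by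
  intro hfib hkrn L
  obtain ⟨c₀, hc₀, hc₀1, H⟩ := hfib L
  obtain ⟨η₀, hη₀, HK⟩ := hkrn L
  refine ⟨c₀, hc₀, hc₀1, fun c hc hcle => ?_⟩
  obtain ⟨pS, H⟩ := H c hc hcle
  refine ⟨pS, fun b₀ p₀ hb hpS hp => ?_⟩
  obtain ⟨γ₁, hγ₁, H⟩ := H b₀ p₀ hb hpS hp
  have hcb : 0 < c * b₀ := mul_pos hc hb
  obtain ⟨γ₂, hγ₂, -, hsmall⟩ := exists_gamma_forall_θBal_le (b₀ := c * b₀) (p₀ := p₀) hcb hp hη₀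
  refine ⟨min γ₁ γ₂, lt_min hγ₁ hγ₂, fun F γ hFL hγ hγle J => ?_⟩
  have hL1 : 1 ≤ F.L := F.hL.2.le
  obtain ⟨r, hr, hex⟩ := H F γ hFL hγ (hγle.trans (min_le_left _ _)) J
  have hη : θBal F.L γ (c * b₀) p₀ (J + 1) - 4 * r ≤ η₀ := by
    have := hsmall F.L hL1 γ hγ (hγle.trans (min_le_right _ _)) (J + 1)
    linarith
  have hhyp : ∀ U : GaugeField (F.P J) 0 (Matrix.specialUnitaryGroup (Fin 2) ℂ), PlaqSmall (θBal F.L γ (c * b₀) p₀ J) U →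
      ∃ W : GaugeField (F.P (J + 1)) 0 (Matrix.specialUnitaryGroup (Fin 2) ℂ), descendTo F ℰp J (J + 1) (Nat.le_succ J) W = U ∧
        ∀ p, dist1 (GaugeField.plaqHol W p) ≤ θBal F.L γ (c * b₀) p₀ (J + 1) - 4 * r := by
    intro U hU
    obtain ⟨W, hWD, hWs⟩ := hex U hU
    exact ⟨W, hWD, fun p => (hWs p).le⟩
  obtain ⟨σ, hσm, hσ⟩ := HK F hFL J _ _ hη hhyp
  refine ⟨r / 2, by linarith, σ, hσm, fun U hU => ?_⟩
  obtain ⟨h1, h2⟩ := hσ U hU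
  refine ⟨h1, fun p => ?_⟩
  have := h2 p
  linarith

end Lift

/-! ## §5b KRN∘ IS A THEOREM TOO: measurable selection on the small-plaquette descent fibres from the tree's Castaing selection
(✓`BalabanUVNodesN08AlphaInB42Sel.exists_measurable_constrained_argmin_of_continuousOn`) and the tree's continuity of the descent on small closed
plaquette classes (✓`MinimiserPin.continuousAt_descendTo_of_plaqLe`) — the pattern of ✓`MinimiserPin.exists_measurable_umin` -/

section Selection

/-- ★ **KRN∘ IS A THEOREM** (`measurableSelection_holds : MeasurableSelectionCan`): with Prop. 2's admissible radius `r(L) = min(1∕(6·C₀), δ₂∕(2(7L)²))`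
(`C₀ = 143·(49∕4)²`) and the guard `η₀(L) = r(L)·L⁻²∕2 < regThreshold_{J,J+1}(r) = r·L⁻²`, the one-step descent is continuous on the OPEN class
`{plaq < regThreshold(r)}` (✓`continuousAt_descendTo_of_plaqLe`), the constraint «`D W = U` and `plaq(W) ≤ η`» is a CLOSED relation between the continuous
map `W ↦ (D W, plaq W)` and the measurable parameter `U ↦ (U, η)`, the configuration space `SU(2)^{bonds}` is compact Polish with Borel = product σ-algebra
(✓`polishSpace_su2`, ✓`secondCountableTopology_su2`), so Castaing's measurable constrained argmin (objective `0`) is a measurable selector of the fibres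
wherever they are nonempty. [cite: Balaban1985Averaging, Prop. 2 p.26; AliprantisBorder2006, Thm 18.19 p.605] -/
theorem measurableSelection_holds : MeasurableSelectionCan := by
  classical
  intro L
  by_cases hL : 1 ≤ L
  swap
  · refine ⟨1, one_pos, fun F hFL => ?_⟩
    have := F.hL.2
    omega
  -- Prop. 2's admissible radius and the guard
  set C₀ : ℝ := 143 * ((((3 + 4 : ℕ) : ℝ)) ^ 2 / 4) ^ 2 with hC₀_def
  have hC₀ : 0 < C₀ := by rw [hC₀_def]; positivity
  have hD : (0 : ℝ) < (((3 + 4) * L : ℕ) : ℝ) ^ 2 := by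
    have : (0 : ℝ) < (((3 + 4) * L : ℕ) : ℝ) := by exact_mod_cast (by omega : 0 < (3 + 4) * L)
    positivity
  set r : ℝ := min (1 / (6 * C₀)) (deltaSU (Fin 2) / (2 * (((3 + 4) * L : ℕ) : ℝ) ^ 2)) with hr_def
  have hr : 0 < r := lt_min (by positivity) (div_pos deltaSU_pos (by positivity))
  have hr3 : C₀ * (2 * r) ≤ 1 / 3 := by
    have h1 : r ≤ 1 / (6 * C₀) := min_le_left _ _
    have h2 : C₀ * (2 * r) ≤ C₀ * (2 * (1 / (6 * C₀))) := by gcongr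
    have h3 : C₀ * (2 * (1 / (6 * C₀))) = 1 / 3 := by field_simp; ring
    linarith
  have hr2 : 2 * (2 * r) ≤ 2 * deltaSU (Fin 2) / (((3 + 4) * L : ℕ) : ℝ) ^ 2 := by
    have h1 : r ≤ deltaSU (Fin 2) / (2 * (((3 + 4) * L : ℕ) : ℝ) ^ 2) := min_le_right _ _
    have h3 : 2 * (2 * (deltaSU (Fin 2) / (2 * (((3 + 4) * L : ℕ) : ℝ) ^ 2))) = 2 * deltaSU (Fin 2) / (((3 + 4) * L : ℕ) : ℝ) ^ 2 := by
      field_simp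
    linarith
  have hLinv : (0 : ℝ) < ((L : ℝ)⁻¹) ^ 2 := by
    have : (0 : ℝ) < (L : ℝ) := by exact_mod_cast (by omega : 0 < L)
    positivity
  set T : ℝ := r * ((L : ℝ)⁻¹) ^ 2 with hT_def
  have hT : 0 < T := mul_pos hr hLinv
  refine ⟨T / 2, by positivity, fun F hFL J θ η hη hex => ?_⟩
  have hJ : J ≤ J + 1 := Nat.le_succ J
  -- the configuration spaces: compact Polish, Borel = product σ-algebra
  haveI := secondCountableTopology_su2
  haveI := polishSpace_su2
  haveI : CompactSpace (GaugeField (F.P (J + 1)) 0 (Matrix.specialUnitaryGroup (Fin 2) ℂ)) := inferInstanceAs (CompactSpace (PBond (F.P (J + 1)) 0 → (Matrix.specialUnitaryGroup (Fin 2) ℂ)))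
  haveI : PolishSpace (GaugeField (F.P (J + 1)) 0 (Matrix.specialUnitaryGroup (Fin 2) ℂ)) := inferInstanceAs (PolishSpace (PBond (F.P (J + 1)) 0 → (Matrix.specialUnitaryGroup (Fin 2) ℂ)))
  haveI : BorelSpace (GaugeField (F.P (J + 1)) 0 (Matrix.specialUnitaryGroup (Fin 2) ℂ)) := inferInstanceAs (BorelSpace (PBond (F.P (J + 1)) 0 → (Matrix.specialUnitaryGroup (Fin 2) ℂ)))
  haveI : SecondCountableTopology (GaugeField (F.P J) 0 (Matrix.specialUnitaryGroup (Fin 2) ℂ)) := inferInstanceAs (SecondCountableTopology (PBond (F.P J) 0 → (Matrix.specialUnitaryGroup (Fin 2) ℂ)))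
  haveI : BorelSpace (GaugeField (F.P J) 0 (Matrix.specialUnitaryGroup (Fin 2) ℂ)) := inferInstanceAs (BorelSpace (PBond (F.P J) 0 → (Matrix.specialUnitaryGroup (Fin 2) ℂ)))
  haveI : T2Space (GaugeField (F.P J) 0 (Matrix.specialUnitaryGroup (Fin 2) ℂ)) := inferInstanceAs (T2Space (PBond (F.P J) 0 → (Matrix.specialUnitaryGroup (Fin 2) ℂ)))
  -- the threshold of the open continuity class
  have hthr : regThreshold F J (J + 1) r = T := by
    show r * ((F.L : ℝ)⁻¹) ^ (2 * (J + 1 - J)) = r * ((L : ℝ)⁻¹) ^ 2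
    rw [Nat.add_sub_cancel_left, mul_one, hFL]
  have hηT : η < regThreshold F J (J + 1) r := by rw [hthr]; linarith
  have hr2F : 2 * (2 * r) ≤ 2 * deltaSU (Fin 2) / (((3 + 4) * F.L : ℕ) : ℝ) ^ 2 := by rw [hFL]; exact hr2
  -- the data of the selection problem
  set Z : Type := GaugeField (F.P J) 0 (Matrix.specialUnitaryGroup (Fin 2) ℂ) × (Plaq (F.P (J + 1)) 0 → ℝ) with hZ_def
  set π : GaugeField (F.P J) 0 (Matrix.specialUnitaryGroup (Fin 2) ℂ) → Z := fun U => (U, fun _ => η) with hπ_def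
  set g : GaugeField (F.P (J + 1)) 0 (Matrix.specialUnitaryGroup (Fin 2) ℂ) → Z := fun W =>
    (descendTo F ℰp J (J + 1) hJ W, fun p => dist1 (GaugeField.plaqHol W p)) with hg_def
  set R : Set (Z × Z) := {q | q.1.1 = q.2.1} ∩ {q | ∀ p, q.1.2 p ≤ q.2.2 p} with hR_def
  set O : Set (GaugeField (F.P (J + 1)) 0 (Matrix.specialUnitaryGroup (Fin 2) ℂ)) := {W | PlaqSmall (regThreshold F J (J + 1) r) W} with hO_def
  have hπ : Measurable π := measurable_id.prodMk measurable_const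
  have hO : IsOpen O := by
    simp only [hO_def, PlaqSmall, setOf_forall]
    exact isOpen_iInter_of_finite fun p => isOpen_lt (continuous_dist1_plaqHol (N := 2) p) continuous_const
  have hg : ContinuousOn g O := by
    refine ContinuousOn.prodMk (fun W hW => ?_) (Continuous.continuousOn ?_)
    · exact (continuousAt_descendTo_of_plaqLe F J (J + 1) hJ hr hr3 hr2F le_rfl fun p => (hW p).le).continuousWithinAt
    · exact continuous_pi fun p => continuous_dist1_plaqHol (N := 2) p
  have hR : IsClosed R := by
    refine IsClosed.inter ?_ ?_
    · exact isClosed_eq (continuous_fst.comp continuous_fst) (continuous_fst.comp continuous_snd)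
    · simp only [setOf_forall]
      exact isClosed_iInter fun p => isClosed_le ((continuous_apply p).comp (continuous_snd.comp continuous_fst))
        ((continuous_apply p).comp (continuous_snd.comp continuous_snd))
  obtain ⟨f, hfm, hfin, -⟩ :=
    exists_measurable_constrained_argmin_of_continuousOn hπ hO hg hR (S := fun _ => (0 : ℝ)) continuous_const 1
  refine ⟨f, hfm, fun U hU => ?_⟩
  obtain ⟨W, hWD, hWp⟩ := hex U hU
  have hWO : W ∈ O := fun p => (hWp p).trans_lt hηT
  have hWR : (g W, π U) ∈ R := ⟨hWD, hWp⟩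
  obtain ⟨⟨-, hfR⟩, -⟩ := hfin U ⟨W, ⟨hWO, hWR⟩, fun z _ => le_rfl⟩
  exact ⟨hfR.1, hfR.2⟩

end Selection


/-! ## §6 THE STUB (1: TUBE∘, as in g22-4), GEOM∘ PROVED, and the by-name PERS₁∘ concluder -/

/-- ★★ **GEOM∘ IS A THEOREM** (`interiorSectionCan_holds : InteriorSectionCan`, the geometry row of LINE g22-4 — body byte-identical — PROVED, sorry-free):
existence by the landed W7 lift (§5), measurability by Castaing selection (§5b). [cite: Balaban1987RG1, (0.4) p.253; Balaban1985UV3, (3) p.256 and (7) p.257] -/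
theorem interiorSectionCan_holds : InteriorSectionCan :=
  interiorSection_of_fibrewise_krn interiorSectionFibrewise_holds measurableSelection_holds

/-- STUB · TUBE∘ (row of LINE g22-4, byte-identical; the ONLY stub of this line). [cite: Balaban1985UV3, (7) p.257 and (38)-(40) p.266] -/
theorem stub_sectionTubeMassIntCan : SectionTubeMassIntCan := by
  sorry

/-- ★ PERS₁∘ ⟸ TUBE∘ ALONE (PROVED junction: GEOM∘ is a theorem, the g22-4 door does the rest). [cite: Balaban1985UV3, (7) p.257 and (38)-(40) p.266] -/
theorem oneLevelPersistence_of_tube : SectionTubeMassIntCan → OneLevelPersistenceIntCan :=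
  oneLevelPersistence_of_geom_tube interiorSectionCan_holds

/-- THE UNIQUE PERS₁∘ CONCLUDER of this line. [cite: Balaban1985UV3, (7) p.257 and (38)-(40) p.266] -/
theorem oneLevelPersistenceIntCan_of_stubs : OneLevelPersistenceIntCan :=
  oneLevelPersistence_of_tube stub_sectionTubeMassIntCan

end Summit.QuantumFields.YangMills.Cruxes.FluctuationComparisonRegPrIntL.RunPairOrgan.SectionLift
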